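import Summits.HodgeConjecture.CorCM.MultiFieldWeilHodge
import Summits.HodgeConjecture.CorCM.OcticDecicWeilGRealised
import Summits.HodgeConjecture.CorCM.SexticDecicWeilHodgeOfMarkman
import HarnessLib

/-!
# COR-CM — TWO FIELDS `8 + 10` THROUGH THE MULTI-FIELD WEIL ENGINE: the Hodge conjecture for every product of copies of `E`, `B₄`, `B₅` — a
# `(1,3)`-fourfold over an OCTIC and a `(2,3)`-fivefold over a DECIC CM field sharing `k` — modulo Markman's hyperbolic-sixfold theorem ONLY,
# with NO hypothesis on the fields

Cell `pub-hodgecm2` (COR-CM), seat b30 gen 28 (2026-08-23); count-neutral own lane (stem `OcticDecicWeil*`); the three-file replacement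
(`Census/OcticDecicWeilGDefect`, `CorCM/OcticDecicWeilG{Realised,HodgeOfMarkman}`) of gen 27ʼs eleven-file chain, with the same headline.
Theorems only; no definition, no named fact, no `sorry`.  HONEST FRAMING: `HC_CM` is NOT proved and not asserted; the only deep input is the
displayed fact `Markman2025_weilClasses_algebraic_hyperbolicSixfold` (the fourfold theorem is NOT needed: no slot has curve multiplicity making a
fourfold).

THE RESULT (`hodgeConjectureFor_biproduct_comp_vec_of_markmanSixfold`).  `k` ANY imaginary quadratic field, `K₂ ⊇ i₂(k)` ANY octic, `K₃ ⊇ i₃(k)`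
ANY decic CM field; `E ⊨ (k; Ψ)` (`τ ∈ Ψ`), `B₄ ⊨ (K₂; Φ₂)` of `k`-signature `(1,3)`, `B₅ ⊨ (K₃; Φ₃)` of `k`-signature `(2,3)`: the Hodge conjecture
for EVERY `E^a × B₄^n × B₅^m` (any order, `⨁_j ![E, B₄, B₅] (κ j)`) and everything dominated.  PROOF = `MultiFieldWeil.hodgeConjectureFor_biproduct_
comp_of_defectLawG` with the defect law `OcticDecicWeilG.exists_hasDefectsG_realisedTuples2` and the two sixfold Weil spaces `B₄ × E × E` (gen 18ʼs
`OcticCurveFourfold.…_of_markmanSixfold`) and `B₅ × E` (b09ʼs `DecicCurveFivefold.…_of_markmanSixfold`).  The Hodge rings contain the sixfold,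
TENFOLD (`E × B₄ × B̄₅`) and FOURTEENFOLD (`B₄ × B̄₅ × B̄₅`) Weil classes — all handled by the engine's single step.
[cite: Markman2025SecantWeil, Thm 1.5.1] [cite: Pohlmann1968, Thm 1] [cite: Milne2020HodgeClassesAV, 1.2 (a) and Thm. 1] [cite: MumfordAV1970, §19]

## References
* [Markman2025SecantWeil] E. Markman, Thm 1.5.1.  [Pohlmann1968] H. Pohlmann, Ann. of Math. 88 (1968), Thm 1.  [Milne2020HodgeClassesAV]
  J. S. Milne, arXiv:2010.08857, 1.2 (a), Thm. 1.  [MumfordAV1970] D. Mumford, *Abelian Varieties*, §19.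
-/

noncomputable section

open CategoryTheory CategoryTheory.Limits NumberField

namespace Summit.HodgeConjecture.CorCM.OcticDecicWeilG

open Literature.AlgebraicGeometry Literature.AlgebraicGeometry.Motives Literature.AlgebraicGeometry.HodgeTheory
open Literature.AlgebraicGeometry.ComplexMultiplication (IsCMTypeRealisation)
open Literature.AlgebraicGeometry.Pohlmann1968
open Literature.AlgebraicTopology.SingularHomology
open Literature.NumberTheory.ComplexMultiplication
open Summit.HodgeConjecture.CorCM.Census.MultiFieldWeil
open Summit.HodgeConjecture.CorCM.Census.OcticDecicWeilG
open Summit.HodgeConjecture.CorCM.MultiFieldWeil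
open Summit.HodgeConjecture.CorCM.SexticOcticWeil (exists_frame_fin card_filter_comp_eq_of_finrank card_filter_cmTypeMap_complexConj)
open Summit.HodgeConjecture.CorCM.SexticDecicWeil (typeCount_sixfold_of_frameSD exists_frame_fin₂)
open Summit.HodgeConjecture.CorCM.OcticWeilMulti (typeCount_sixfold_of_frameO)
open Summit.HodgeConjecture.CorCM.PairWeights

open scoped Classical

/-! ## §1 The frame form -/

section Frames

variable {I : Type} {Kf : I → Type} [∀ i, Field (Kf i)] [∀ i, NumberField (Kf i)] [∀ i, IsCMField (Kf i)]
  {i₀ : I} {is : Fin 2 → I} {τ : Kf i₀ →+* ℂ}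
  {A : Fin (2 + 1) → AbelianVariety ℂ} {Φ : ∀ j : Fin (2 + 1), CMType (Kf (mfSlots i₀ is j))}
  {ι : ∀ j, 𝓞 (Kf (mfSlots i₀ is j)) →+* End (A j)}
  {θ : ∀ j, Kf (mfSlots i₀ is j) →+* Module.End ℂ (complexBetti (A j).X 1)}

/-- **MAIN THEOREM (frame form).  The Hodge conjecture for every product of copies `⨁_j A(κ j)` of `E, B₄, B₅` — GIVEN ONLY Markman's
hyperbolic-sixfold theorem (the Weil classes of `B₄ × E × E` and of `B₅ × E`)**, for `E = A 0 ⊨ (k; {τ})`, `B₄ = A 1 ⊨ (K₂; Φ 1)` over an OCTIC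
`K₂ ⊇ i₂(k)` (one member over `τ`, position `0` of `e₂`), `B₅ = A 2 ⊨ (K₃; Φ 2)` over a DECIC `K₃ ⊇ i₃(k)` (two members over `τ`, positions `0, 1` of
`e₃`); NO hypothesis relating the fields.  `HC_CM` is NOT asserted. [cite: Markman2025SecantWeil, Thm 1.5.1] [cite: Pohlmann1968, Thm 1]
[cite: Milne2020HodgeClassesAV, 1.2 (a) and Thm. 1] -/
theorem hodgeConjectureFor_biproduct_comp_of_frames_of_markmanSixfold (hM6 : Markman2025_weilClasses_algebraic_hyperbolicSixfold)
    {N : ℕ} (κ : Fin N → Fin (2 + 1)) (h8 : Module.finrank ℚ (Kf (is 0)) = 8) (h10 : Module.finrank ℚ (Kf (is 1)) = 10)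
    (h2 : Module.finrank ℚ (Kf i₀) = 2) (i₂ : Kf i₀ →+* Kf (is 0)) (i₃ : Kf i₀ →+* Kf (is 1))
    {δ : 𝓞 (Kf i₀)} {d : ℕ} (hd : 0 < d) (hδ : ((δ : Kf i₀)) ^ 2 = -(d : Kf i₀)) (hτ : τ (δ : Kf i₀) = Complex.I * (Real.sqrt d : ℂ))
    (hA : ∀ j, IsCMTypeRealisation (Φ j) (A j) (ι j) (θ j))
    (e₂ : (Kf (is 0) →+* ℂ) ≃ Fin 4 × Bool) (e₃ : (Kf (is 1) →+* ℂ) ≃ Fin 5 × Bool)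
    (he₂_sign : ∀ s, (e₂ s).2 = true ↔ s.comp i₂ = τ) (he₃_sign : ∀ s, (e₃ s).2 = true ↔ s.comp i₃ = τ)
    (he₂_conj : ∀ s, e₂ (ComplexEmbedding.conjugate s) = ((e₂ s).1, !(e₂ s).2))
    (he₃_conj : ∀ s, e₃ (ComplexEmbedding.conjugate s) = ((e₃ s).1, !(e₃ s).2))
    (hΨ : ∀ σ : Kf i₀ →+* ℂ, σ ∈ (Φ 0).1 ↔ σ = τ)
    (hΦ₂ : ∀ s : Kf (is 0) →+* ℂ, s ∈ (Φ 1).1 ↔ (e₂ s).2 = decide ((e₂ s).1 = 0))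
    (hΦ₃ : ∀ s : Kf (is 1) →+* ℂ, s ∈ (Φ 2).1 ↔ (e₃ s).2 = decide ((e₃ s).1 = 0 ∨ (e₃ s).1 = 1)) :
    HodgeConjectureFor (⨁ fun j => A (κ j)).dim (⨁ fun j => A (κ j)).X := by
  -- the two sixfold Weil spaces, algebraic by Markman's theorem
  have hP : ((Finset.univ : Finset (Fin 4)).filter fun a => (fun (_ : Fin 1) (a : Fin 4) => decide (a = 0)) 0 a = true).card = 1 := by
    decide
  have hW1 : weilClassesOf (((A 1).prod (A 0)).prod (A 0))
      (AbelianVariety.prodLift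
        (AbelianVariety.fst ((A 1).prod (A 0)) (A 0) ≫
          AbelianVariety.prodLift (AbelianVariety.fst (A 1) (A 0) ≫ ι 1 (RingOfIntegers.mapRingHom i₂ δ))
            (AbelianVariety.snd (A 1) (A 0) ≫ ι 0 δ))
        (AbelianVariety.snd ((A 1).prod (A 0)) (A 0) ≫ ι 0 δ)) 3 d ≤ algebraicClasses (((A 1).prod (A 0)).prod (A 0)).X 3 :=
    OcticCurveFourfold.weilClassesOf_le_algebraicClasses_cmFourfold_prod_cmCurve_prod_cmCurve_of_markmanSixfold hM6 h8 h2 i₂ (hA 1) (hA 0) hd hδ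
      fun τ' => typeCount_sixfold_of_frameO (P := fun (_ : Fin 1) (a : Fin 4) => decide (a = 0)) (m := 0) h2 he₂_sign hP hΦ₂ hΨ τ'
  have hW2 : weilClassesOf ((A 2).prod (A 0))
      (AbelianVariety.prodLift (AbelianVariety.fst (A 2) (A 0) ≫ ι 2 (RingOfIntegers.mapRingHom i₃ δ))
        (AbelianVariety.snd (A 2) (A 0) ≫ ι 0 δ)) 3 d ≤ algebraicClasses ((A 2).prod (A 0)).X 3 :=
    DecicCurveFivefold.weilClassesOf_le_algebraicClasses_cmFivefold_prod_cmCurve_of_markmanSixfold hM6 h10 h2 i₃ (hA 2) (hA 0) hd hδ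
      fun τ' => typeCount_sixfold_of_frameSD h2 he₃_sign hΦ₃ hΨ τ'
  have hW : ∀ m : Fin 2, weilClassesOf (⨁ fun i => A (partSlots (c2 m) m i))
      (biproduct.map fun i => ι (partSlots (c2 m) m i) (δfam (im2 is i₂ i₃) δ (partSlots (c2 m) m i))) (w2 m) d ≤
      algebraicClasses (⨁ fun i => A (partSlots (c2 m) m i)).X (w2 m) := by
    intro m
    refine Fin.cases ?_ (fun m => Fin.cases ?_ (fun m => m.elim0) m) m
    · exact OcticCurveFourfold.weilClassesOf_biproduct₃_le_algebraicClasses_of_prod (A := fun i => A (partSlots 2 0 i))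
        (fun i => ι (partSlots 2 0 i) (δfam (im2 is i₂ i₃) δ (partSlots 2 0 i))) hW1
    · exact weilClassesOf_biproduct_le_algebraicClasses_of_prod (A := fun i => A (partSlots 1 1 i))
        (fun i => ι (partSlots 1 1 i) (δfam (im2 is i₂ i₃) δ (partSlots 1 1 i))) hW2
  exact hodgeConjectureFor_biproduct_comp_of_defectLawG (is := is) P2 c2 w2 n2_add_c2 c2_lt_n2 κ h2 (im2 is i₂ i₃) hτ hA
    (e2 is e₂ e₃) (he2_sign (is := is) he₂_sign he₃_sign) (he2_conj (is := is) he₂_conj he₃_conj) hΨ (hΦ2 (is := is) hΦ₂ hΦ₃)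
    (fun v T hT => exists_hasDefectsG_realisedTuples2 he₂_sign he₃_sign v T hT) hW

end Frames

/-! ## §2 The intrinsic theorem for `⨁_j ![E, B₄, B₅] (κ j)` -/

section Vec

variable {k K₂ K₃ : Type} [Field k] [NumberField k] [IsCMField k] [Field K₂] [NumberField K₂] [IsCMField K₂]
  [Field K₃] [NumberField K₃] [IsCMField K₃] {N : ℕ}
  {E B₄ B₅ : AbelianVariety ℂ} {Ψ : CMType k} {Φ₂ : CMType K₂} {Φ₃ : CMType K₃}
  {ιE : 𝓞 k →+* End E} {θE : k →+* Module.End ℂ (complexBetti E.X 1)}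
  {ιB₄ : 𝓞 K₂ →+* End B₄} {θB₄ : K₂ →+* Module.End ℂ (complexBetti B₄.X 1)}
  {ιB₅ : 𝓞 K₃ →+* End B₅} {θB₅ : K₃ →+* Module.End ℂ (complexBetti B₅.X 1)}

/-- **MAIN THEOREM (intrinsic form).  The Hodge conjecture for every product of copies of `E`, `B₄`, `B₅` — `E^a × B₄^n × B₅^m`, any order
(`⨁_j ![E, B₄, B₅] (κ j)`) — GIVEN ONLY Markman's hyperbolic-sixfold theorem**: `k` imaginary quadratic, `K₂ ⊇ i₂(k)` ANY octic, `K₃ ⊇ i₃(k)` ANY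
decic CM field, `E ⊨ (k; Ψ)` (`τ ∈ Ψ`), `B₄ ⊨ (K₂; Φ₂)` with exactly ONE member over `τ` (`(1,3)`), `B₅ ⊨ (K₃; Φ₃)` with exactly TWO (`(2,3)`).
NO hypothesis relating the fields, NO Galois hypothesis.  `HC_CM` is NOT asserted. [cite: Markman2025SecantWeil, Thm 1.5.1] [cite: Pohlmann1968, Thm 1] -/
theorem hodgeConjectureFor_biproduct_comp_vec_of_markmanSixfold (hM6 : Markman2025_weilClasses_algebraic_hyperbolicSixfold)
    (h2 : Module.finrank ℚ k = 2) (h8 : Module.finrank ℚ K₂ = 8) (h10 : Module.finrank ℚ K₃ = 10) (i₂ : k →+* K₂) (i₃ : k →+* K₃)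
    (hE : IsCMTypeRealisation Ψ E ιE θE) (hB₄ : IsCMTypeRealisation Φ₂ B₄ ιB₄ θB₄) (hB₅ : IsCMTypeRealisation Φ₃ B₅ ιB₅ θB₅)
    {τ : k →+* ℂ} (hτΨ : τ ∈ Ψ.1)
    (h13 : (Finset.univ.filter fun t : K₂ →+* ℂ => t.comp i₂ = τ ∧ t ∈ Φ₂.1).card = 1)
    (h23 : (Finset.univ.filter fun u : K₃ →+* ℂ => u.comp i₃ = τ ∧ u ∈ Φ₃.1).card = 2)
    (κ : Fin N → Fin 3) :
    HodgeConjectureFor (⨁ fun j => (![E, B₄, B₅] : Fin 3 → AbelianVariety ℂ) (κ j)).dim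
      (⨁ fun j => (![E, B₄, B₅] : Fin 3 → AbelianVariety ℂ) (κ j)).X := by
  have hττ : ComplexEmbedding.conjugate τ ≠ τ := QuarticCM.conjugate_ne τ
  have hk : ∀ σ : k →+* ℂ, σ = τ ∨ σ = ComplexEmbedding.conjugate τ := fun σ => QuarticCM.eq_or_eq_conjugate_of_quadratic h2 τ σ
  have hΨ : ∀ σ : k →+* ℂ, σ ∈ Ψ.1 ↔ σ = τ := by
    intro σ
    rcases hk σ with rfl | rfl
    · exact ⟨fun _ => rfl, fun _ => hτΨ⟩
    · exact ⟨fun h => absurd h ((Ψ.2 τ).1 hτΨ), fun h => absurd h hττ⟩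
  obtain ⟨δ₀, d, hd, hδ₀⟩ := CyclicSextic.exists_sq_eq_neg_nat_of_isTotallyComplex k h2
  obtain ⟨δ, hδ, hτ⟩ := OcticCurveFourfold.exists_delta_of_mem h2 hd hδ₀ τ
  obtain ⟨e₂, he₂_sign, he₂_conj, hΦ₂⟩ := exists_frame_fin (n := 3) i₂ hττ hk
    (card_filter_comp_eq_of_finrank (n := 4) i₂ h8 h2 τ) Φ₂ h13
  obtain ⟨e₃, he₃_sign, he₃_conj, hΦ₃⟩ := exists_frame_fin₂ h10 h2 i₃ hττ hk Φ₃ h23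
  let Kf : Fin 3 → Type := Fin.cons k (Fin.cons K₂ (Fin.cons K₃ finZeroElim))
  letI instF : ∀ j, Field (Kf j) := Fin.cons ‹Field k› (Fin.cons ‹Field K₂› (Fin.cons ‹Field K₃› finZeroElim))
  letI instN : ∀ j, NumberField (Kf j) := Fin.cons ‹NumberField k› (Fin.cons ‹NumberField K₂› (Fin.cons ‹NumberField K₃› finZeroElim))
  haveI instC : ∀ j, IsCMField (Kf j) := Fin.cons ‹IsCMField k› (Fin.cons ‹IsCMField K₂› (Fin.cons ‹IsCMField K₃› finZeroElim))
  let Φf : ∀ j : Fin 3, CMType (Kf (mfSlots (0 : Fin 3) Fin.succ j)) := Fin.cons Ψ (Fin.cons Φ₂ (Fin.cons Φ₃ finZeroElim))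
  let ιf : ∀ j : Fin 3, 𝓞 (Kf (mfSlots (0 : Fin 3) Fin.succ j)) →+* End ((![E, B₄, B₅] : Fin 3 → AbelianVariety ℂ) j) :=
    Fin.cons ιE (Fin.cons ιB₄ (Fin.cons ιB₅ finZeroElim))
  let θf : ∀ j : Fin 3, Kf (mfSlots (0 : Fin 3) Fin.succ j) →+* Module.End ℂ (complexBetti ((![E, B₄, B₅] : Fin 3 → AbelianVariety ℂ) j).X 1) :=
    Fin.cons θE (Fin.cons θB₄ (Fin.cons θB₅ finZeroElim))
  have hA : ∀ j, IsCMTypeRealisation (Φf j) ((![E, B₄, B₅] : Fin 3 → AbelianVariety ℂ) j) (ιf j) (θf j) :=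
    Fin.cons hE (Fin.cons hB₄ (Fin.cons hB₅ finZeroElim))
  exact hodgeConjectureFor_biproduct_comp_of_frames_of_markmanSixfold (Kf := Kf) (i₀ := (0 : Fin 3)) (is := Fin.succ)
    (A := (![E, B₄, B₅] : Fin 3 → AbelianVariety ℂ)) (Φ := Φf) (ι := ιf) (θ := θf)
    hM6 κ h8 h10 h2 i₂ i₃ hd hδ hτ hA e₂ e₃ he₂_sign he₃_sign he₂_conj he₃_conj hΨ hΦ₂ hΦ₃

/-- **All `k`-signatures `(1,3)/(3,1) × (2,3)/(3,2)`** via the conjugate structures. [cite: Markman2025SecantWeil, Thm 1.5.1] [cite: Pohlmann1968, Thm 1] -/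
theorem hodgeConjectureFor_biproduct_comp_vec_of_markmanSixfold_of_signs (hM6 : Markman2025_weilClasses_algebraic_hyperbolicSixfold)
    (h2 : Module.finrank ℚ k = 2) (h8 : Module.finrank ℚ K₂ = 8) (h10 : Module.finrank ℚ K₃ = 10) (i₂ : k →+* K₂) (i₃ : k →+* K₃)
    (hE : IsCMTypeRealisation Ψ E ιE θE) (hB₄ : IsCMTypeRealisation Φ₂ B₄ ιB₄ θB₄) (hB₅ : IsCMTypeRealisation Φ₃ B₅ ιB₅ θB₅)
    {τ : k →+* ℂ} (hτΨ : τ ∈ Ψ.1)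
    (h13 : (Finset.univ.filter fun t : K₂ →+* ℂ => t.comp i₂ = τ ∧ t ∈ Φ₂.1).card = 1 ∨
      (Finset.univ.filter fun t : K₂ →+* ℂ => t.comp i₂ = τ ∧ t ∈ Φ₂.1).card = 3)
    (h23 : (Finset.univ.filter fun u : K₃ →+* ℂ => u.comp i₃ = τ ∧ u ∈ Φ₃.1).card = 2 ∨
      (Finset.univ.filter fun u : K₃ →+* ℂ => u.comp i₃ = τ ∧ u ∈ Φ₃.1).card = 3)
    (κ : Fin N → Fin 3) :
    HodgeConjectureFor (⨁ fun j => (![E, B₄, B₅] : Fin 3 → AbelianVariety ℂ) (κ j)).dim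
      (⨁ fun j => (![E, B₄, B₅] : Fin 3 → AbelianVariety ℂ) (κ j)).X := by
  have hn₂ := card_filter_comp_eq_of_finrank (n := 4) i₂ h8 h2 τ
  have hn₃ := card_filter_comp_eq_of_finrank (n := 5) i₃ h10 h2 τ
  have hB₄' : ∃ (Φ₂' : CMType K₂) (ι' : 𝓞 K₂ →+* End B₄) (θ' : K₂ →+* Module.End ℂ (complexBetti B₄.X 1)),
      IsCMTypeRealisation Φ₂' B₄ ι' θ' ∧ (Finset.univ.filter fun t : K₂ →+* ℂ => t.comp i₂ = τ ∧ t ∈ Φ₂'.1).card = 1 := by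
    rcases h13 with h | h
    · exact ⟨Φ₂, ιB₄, θB₄, hB₄, h⟩
    · refine ⟨_, _, _, hB₄.transport (IsCMField.complexConj K₂).toRingEquiv, ?_⟩
      rw [card_filter_cmTypeMap_complexConj i₂ τ Φ₂, hn₂, h]
  have hB₅' : ∃ (Φ₃' : CMType K₃) (ι' : 𝓞 K₃ →+* End B₅) (θ' : K₃ →+* Module.End ℂ (complexBetti B₅.X 1)),
      IsCMTypeRealisation Φ₃' B₅ ι' θ' ∧ (Finset.univ.filter fun u : K₃ →+* ℂ => u.comp i₃ = τ ∧ u ∈ Φ₃'.1).card = 2 := by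
    rcases h23 with h | h
    · exact ⟨Φ₃, ιB₅, θB₅, hB₅, h⟩
    · refine ⟨_, _, _, hB₅.transport (IsCMField.complexConj K₃).toRingEquiv, ?_⟩
      rw [card_filter_cmTypeMap_complexConj i₃ τ Φ₃, hn₃, h]
  obtain ⟨Φ₂', ι₄', θ₄', hB₄'', h13'⟩ := hB₄'
  obtain ⟨Φ₃', ι₅', θ₅', hB₅'', h23'⟩ := hB₅'
  exact hodgeConjectureFor_biproduct_comp_vec_of_markmanSixfold hM6 h2 h8 h10 i₂ i₃ hE hB₄'' hB₅'' hτΨ h13' h23' κ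

/-- **The Hodge conjecture for every abelian variety dominated by a product of copies of `E`, `B₄`, `B₅`** (intrinsic form, all signs), modulo
Markman's hyperbolic-sixfold theorem only. [cite: Markman2025SecantWeil, Thm 1.5.1] [cite: MumfordAV1970, §19] -/
theorem hodgeConjectureFor_of_avDominatedBy_comp_vec_of_markmanSixfold (hM6 : Markman2025_weilClasses_algebraic_hyperbolicSixfold)
    (h2 : Module.finrank ℚ k = 2) (h8 : Module.finrank ℚ K₂ = 8) (h10 : Module.finrank ℚ K₃ = 10) (i₂ : k →+* K₂) (i₃ : k →+* K₃)
    (hE : IsCMTypeRealisation Ψ E ιE θE) (hB₄ : IsCMTypeRealisation Φ₂ B₄ ιB₄ θB₄) (hB₅ : IsCMTypeRealisation Φ₃ B₅ ιB₅ θB₅)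
    {τ : k →+* ℂ} (hτΨ : τ ∈ Ψ.1)
    (h13 : (Finset.univ.filter fun t : K₂ →+* ℂ => t.comp i₂ = τ ∧ t ∈ Φ₂.1).card = 1 ∨
      (Finset.univ.filter fun t : K₂ →+* ℂ => t.comp i₂ = τ ∧ t ∈ Φ₂.1).card = 3)
    (h23 : (Finset.univ.filter fun u : K₃ →+* ℂ => u.comp i₃ = τ ∧ u ∈ Φ₃.1).card = 2 ∨
      (Finset.univ.filter fun u : K₃ →+* ℂ => u.comp i₃ = τ ∧ u ∈ Φ₃.1).card = 3)
    (κ : Fin N → Fin 3) {X : AbelianVariety ℂ} (hX : Domination.AVDominatedBy X (⨁ fun j => (![E, B₄, B₅] : Fin 3 → AbelianVariety ℂ) (κ j))) :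
    HodgeConjectureFor X.dim X.X :=
  Domination.hodgeConjectureFor_of_avDominatedBy
    (hodgeConjectureFor_biproduct_comp_vec_of_markmanSixfold_of_signs hM6 h2 h8 h10 i₂ i₃ hE hB₄ hB₅ hτΨ h13 h23 κ) hX

end Vec

end Summit.HodgeConjecture.CorCM.OcticDecicWeilG

end
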